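import Summits.ResolutionOfSingularities.ResolutionOfSingularities.Theorems.EquisingularLiftEquisingularLiftNatModelStepChain
import Summits.ResolutionOfSingularities.ResolutionOfSingularities.Theorems.EquisingularLiftEquisingularLiftChainRegular
import Mathlib.AlgebraicGeometry.Morphisms.Smooth
import HarnessLib

/-!
# [OURS · L1 W4.5(b) · EL♮] WORKED SUPPLIER FOR K5: the carrier lift `HΔ(Adm)` (T-ISO-0⁺) IS a sub-chain supplier `HSUB(ReachΔ Adm)`
# — so T-ISO-0⁺ (p519428) is literally the one-Δ-step instance of the engine K5′ (`target_elnat_of_subchainResolution'`)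

Crux `EquisingularLiftNat` = stmt-ResolutionOfSingularities-20038 (child EL♮(3) = stmt-20148), route EquisingularLift, line `sections`;
helper file `--supports … --as helper` by res-D-pv-029. HONEST FRAMING: OURS; NOT a statement of any manuscript. AI-written, weaker than
expert review. No `sorry`; standard axioms.

`hsub_of_carrierLift`: from T-ISO-0⁺'s lift hypothesis `HΔ(Adm)` (with the T-DIM antecedent, verbatim as in …NatDeltaPointResolutionDim)
to K5′'s sub-chain supplier `HSUB(ReachΔ Adm)` (verbatim as in …NatSubchainPointResolutionOff) for the ONE-STEP reachability
`ReachΔ Adm F₁ F₂ υ x T₂ F₉ β T₉ :⟺ ∃ Z, Adm F₁ F₂ υ x Z ∧ supp Z ⊆ T₂ ∧ IsBlowup β Z ∧ T₉ = closure β⁻¹(T₂ ∖ supp Z)`.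
It is the TEMPLATE for suppliers of longer sub-chains (res-L1-w45b-stub-1's T-M1-SCHEME for lead-2's v7 (TC⁺)): call the engine's
iteration brick `modelStep_chain` (…NatModelStepChain) once per admissible centre; certify «off-generic» by
`off_generic_of_subset_preimage` from «supp C ⊆ carrier» and the handed fact about `σ' '' supp (ker s)`; «`T ⊄ supp Z`» holds because
the lift puts `supp Z` inside the exceptional locus.
-/

set_option linter.dupNamespace false -- mandated namespace `Summit.<Summit>.<Problem>` of this single-conjunct summit
set_option linter.overlappingInstances false -- signatures carry `[IsDomain O] [IsDiscreteValuationRing O]`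

noncomputable section

open CategoryTheory CategoryTheory.Limits AlgebraicGeometry TopologicalSpace Topology
open Literature.AlgebraicGeometry.Resolution
open AlgebraicGeometry.Scheme.IdealSheafData
open Summit.ResolutionOfSingularities.ResolutionOfSingularities.Theses.EquisingularLift.Split
open Summit.ResolutionOfSingularities.ResolutionOfSingularities.Cruxes.EquisingularLift.StrataSplit

namespace Summit.ResolutionOfSingularities.ResolutionOfSingularities.Cruxes.EquisingularLiftNat.Sections

/-- **The carrier lift is a one-step sub-chain supplier** (see the module docstring). [folklore; K2 `modelStep` + bookkeeping] -/
theorem hsub_of_carrierLift (k : Type) [Field k] (n : ℕ)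
    (Adm : ∀ (F₁ F₂ : AlgebraicGeometry.Scheme.{0}), (F₂ ⟶ F₁) → F₁ → F₂.IdealSheafData → Prop)
    (HΔ : ∀ (O : Type) [CommRing O] [IsDomain O] [IsDiscreteValuationRing O] [IsAdicComplete (IsLocalRing.maximalIdeal O) O]
        [IsAlgClosed (IsLocalRing.ResidueField O)] (θ : O →+* k), Function.Surjective θ →
      ∀ (X' : AlgebraicGeometry.Scheme.{0}) (r' : X' ⟶ AlgebraicGeometry.Spec (.of O)) [AlgebraicGeometry.IsIntegral X']
        [IsLocallyNoetherian X'], Literature.AlgebraicGeometry.Resolution.Scheme.IsRegular X' → AlgebraicGeometry.IsProper r' →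
      ∀ (U : X'.Opens), AlgebraicGeometry.Smooth (U.ι ≫ r') →
      ∀ (s : AlgebraicGeometry.Spec (.of O) ⟶ X'), s ≫ r' = 𝟙 _ → s (IsLocalRing.closedPoint O) ∈ U →
      ringKrullDim (X'.presheaf.stalk (s (IsLocalRing.closedPoint O))) = ((n + 1 : ℕ) : WithBot ℕ∞) →
      ∀ (X₁ : AlgebraicGeometry.Scheme.{0}) (τ₁ : X₁ ⟶ X'), Literature.AlgebraicGeometry.Resolution.IsBlowup τ₁ s.ker →
      -- the model squares: `F₁` is the special fibre of `X'`, `x` the point under the section, `υ` the blow-up of the reduced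
      -- point `x`, `F₂` the special fibre of `X₁`, the carrier `(ker s · 𝒪_{X₁}) · 𝒪_{F₂} = 𝔪_x · 𝒪_{F₂}`
      ∀ (F₁ : AlgebraicGeometry.Scheme.{0}) [AlgebraicGeometry.IsIntegral F₁] (j : F₁ ⟶ X')
        (t : F₁ ⟶ AlgebraicGeometry.Spec (.of k)),
        IsPullback j t r' (AlgebraicGeometry.Spec.map (CommRingCat.ofHom θ)) →
      ∀ (x : F₁) (hx : IsClosed ({x} : Set F₁)), s (IsLocalRing.closedPoint O) = j x →
      ∀ (F₂ : AlgebraicGeometry.Scheme.{0}) [AlgebraicGeometry.IsIntegral F₂] (υ : F₂ ⟶ F₁),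
        Literature.AlgebraicGeometry.Resolution.IsBlowup υ
          (AlgebraicGeometry.Scheme.IdealSheafData.vanishingIdeal (⟨{x}, hx⟩ : TopologicalSpace.Closeds F₁)) →
      ∀ (j₂ : F₂ ⟶ X₁) (t₂ : F₂ ⟶ AlgebraicGeometry.Spec (.of k)),
        IsPullback j₂ t₂ (τ₁ ≫ r') (AlgebraicGeometry.Spec.map (CommRingCat.ofHom θ)) → j₂ ≫ τ₁ = υ ≫ j →
        (s.ker.comap τ₁).comap j₂ =
          (AlgebraicGeometry.Scheme.IdealSheafData.vanishingIdeal (⟨{x}, hx⟩ : TopologicalSpace.Closeds F₁)).comap υ →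
      ∀ Z : F₂.IdealSheafData, Adm F₁ F₂ υ x Z →
        ∃ C : X₁.IdealSheafData, Literature.AlgebraicGeometry.Resolution.Scheme.IsRegular C.subscheme ∧
          AlgebraicGeometry.Flat (C.subschemeι ≫ τ₁ ≫ r') ∧
          (C.support : Set X₁) ⊆ ((s.ker.comap τ₁).support : Set X₁) ∧ C.comap j₂ = Z) :
    ∀ (O : Type) [CommRing O] [IsDomain O] [IsDiscreteValuationRing O] [IsAdicComplete (IsLocalRing.maximalIdeal O) O]
        [IsAlgClosed (IsLocalRing.ResidueField O)] (θ : O →+* k), Function.Surjective θ →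
      ∀ (P : AlgebraicGeometry.Scheme.{0}) (q : P ⟶ AlgebraicGeometry.Spec (.of O)) (Y : Set P)
        (Ch : ∀ X' : AlgebraicGeometry.Scheme.{0}, (X' ⟶ P) → Set X' → Prop),
        (∀ (X' X'' : AlgebraicGeometry.Scheme.{0}) (σ' : X' ⟶ P) (S' : Set X') (C : X'.IdealSheafData) (τ : X'' ⟶ X'),
          Ch X' σ' S' → Literature.AlgebraicGeometry.Resolution.IsBlowup τ C →
          Literature.AlgebraicGeometry.Resolution.Scheme.IsRegular C.subscheme → AlgebraicGeometry.Flat (C.subschemeι ≫ σ' ≫ q) →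
          σ' '' (C.support : Set X') ⊆ {y | ¬ IsGenericPoint y Y} →
          (C.support : Set X') ∩ (σ' ≫ q) ⁻¹' {IsLocalRing.closedPoint O} ⊆ S' →
          Ch X'' (τ ≫ σ') (closure (τ ⁻¹' (S' \ (C.support : Set X'))))) →
        (∀ (X' : AlgebraicGeometry.Scheme.{0}) (σ' : X' ⟶ P) (S' : Set X'), Ch X' σ' S' →
          Summit.ResolutionOfSingularities.ResolutionOfSingularities.Theses.EquisingularLift.Split.Chain P Y X' σ' S') →
        Y ⊆ q ⁻¹' {IsLocalRing.closedPoint O} → IsIrreducible Y → IsClosed Y →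
        AlgebraicGeometry.IsIntegral P → IsLocallyNoetherian P → Literature.AlgebraicGeometry.Resolution.Scheme.IsRegular P →
        AlgebraicGeometry.IsProper q → AlgebraicGeometry.SmoothOfRelativeDimension n q →
      -- the stage before the point step and its model
      ∀ (X' : AlgebraicGeometry.Scheme.{0}) (σ' : X' ⟶ P) (S' : Set X'), Ch X' σ' S' → AlgebraicGeometry.IsIntegral X' →
        IsLocallyNoetherian X' → Literature.AlgebraicGeometry.Resolution.Scheme.IsRegular X' →
        AlgebraicGeometry.IsDominant (σ' ≫ q) →
      ∀ (F₁ : AlgebraicGeometry.Scheme.{0}), AlgebraicGeometry.IsIntegral F₁ → ∀ (j : F₁ ⟶ X')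
        (t : F₁ ⟶ AlgebraicGeometry.Spec (.of k)),
        IsPullback j t (σ' ≫ q) (AlgebraicGeometry.Spec.map (CommRingCat.ofHom θ)) →
      ∀ (T₁ : Set F₁), IsClosed T₁ → IsIrreducible T₁ → j '' T₁ = S' →
      -- the point step: section, its blow-up, the new stage and its model
      ∀ (x : F₁) (hx : IsClosed ({x} : Set F₁)) (U : X'.Opens), AlgebraicGeometry.Smooth (U.ι ≫ σ' ≫ q) →
      ∀ (s : AlgebraicGeometry.Spec (.of O) ⟶ X'), s ≫ σ' ≫ q = 𝟙 _ → s (IsLocalRing.closedPoint O) ∈ U →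
        s (IsLocalRing.closedPoint O) = j x →
        ringKrullDim (X'.presheaf.stalk (s (IsLocalRing.closedPoint O))) = ((n + 1 : ℕ) : WithBot ℕ∞) →
        IsRegularLocalRing (F₁.presheaf.stalk x) →
        (∀ c ∈ (s.ker.support : Set X'), ¬ IsGenericPoint (σ' c) Y) →
      ∀ (X₁ : AlgebraicGeometry.Scheme.{0}) (τ₁ : X₁ ⟶ X'), Literature.AlgebraicGeometry.Resolution.IsBlowup τ₁ s.ker →
        AlgebraicGeometry.IsIntegral X₁ → IsLocallyNoetherian X₁ → Literature.AlgebraicGeometry.Resolution.Scheme.IsRegular X₁ →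
        AlgebraicGeometry.IsDominant ((τ₁ ≫ σ') ≫ q) →
      ∀ (F₂ : AlgebraicGeometry.Scheme.{0}), AlgebraicGeometry.IsIntegral F₂ → ∀ (υ : F₂ ⟶ F₁),
        Literature.AlgebraicGeometry.Resolution.IsBlowup υ
          (AlgebraicGeometry.Scheme.IdealSheafData.vanishingIdeal (⟨{x}, hx⟩ : TopologicalSpace.Closeds F₁)) →
      ∀ (j₂ : F₂ ⟶ X₁) (t₂ : F₂ ⟶ AlgebraicGeometry.Spec (.of k)),
        IsPullback j₂ t₂ ((τ₁ ≫ σ') ≫ q) (AlgebraicGeometry.Spec.map (CommRingCat.ofHom θ)) → j₂ ≫ τ₁ = υ ≫ j →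
        (s.ker.comap τ₁).comap j₂ =
          (AlgebraicGeometry.Scheme.IdealSheafData.vanishingIdeal (⟨{x}, hx⟩ : TopologicalSpace.Closeds F₁)).comap υ →
        IsIrreducible (closure (υ ⁻¹' (T₁ \ {x}))) →
        Ch X₁ (τ₁ ≫ σ') (j₂ '' closure (υ ⁻¹' (T₁ \ {x}))) →
      -- the admissible downstairs sub-chains are matched upstairs
      ∀ (F₉ : AlgebraicGeometry.Scheme.{0}) (β : F₉ ⟶ F₂) (T₉ : Set F₉), (∃ Z : F₂.IdealSheafData, Adm F₁ F₂ υ x Z ∧ (Z.support : Set F₂) ⊆ closure (υ ⁻¹' (T₁ \ {x})) ∧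
          Literature.AlgebraicGeometry.Resolution.IsBlowup β Z ∧
          T₉ = closure (β ⁻¹' (closure (υ ⁻¹' (T₁ \ {x})) \ (Z.support : Set F₂)))) →
        ∃ (X₉ : AlgebraicGeometry.Scheme.{0}) (σ₉ : X₉ ⟶ P) (S₉ : Set X₉) (j₉ : F₉ ⟶ X₉)
          (t₉ : F₉ ⟶ AlgebraicGeometry.Spec (.of k)),
          Ch X₉ σ₉ S₉ ∧ AlgebraicGeometry.IsIntegral X₉ ∧ IsLocallyNoetherian X₉ ∧
          Literature.AlgebraicGeometry.Resolution.Scheme.IsRegular X₉ ∧ AlgebraicGeometry.IsDominant (σ₉ ≫ q) ∧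
          IsPullback j₉ t₉ (σ₉ ≫ q) (AlgebraicGeometry.Spec.map (CommRingCat.ofHom θ)) ∧ j₉ '' T₉ = S₉ ∧
          IsClosed T₉ ∧ IsIrreducible T₉ ∧ AlgebraicGeometry.IsIntegral F₉ := by
  intro O _ _ _ _ _ θ hθ P q Y Ch hStep hChain hY hYirr hYcl hPint hPnoeth hPreg hprop hsrd X' σ' S' hChX hX'int hX'noeth
    hX'reg hdom F₁ hF₁ j t hsq T₁ hT₁cl hT₁irr hTS x hx U hU s hs hsU hss₀ hdim hFreg hoffs X₁ τ₁ hτ₁ hX₁int hX₁noeth hX₁reg hdom₁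
    F₂ hF₂ υ hυ j₂ t₂ hsq₂ hcomm hE hT₂irr hCh₁ F₉ β T₉ hReach
  obtain ⟨Z, hAdm, hZT, hβ, rfl⟩ := hReach
  haveI := hX'int
  haveI := hX'noeth
  haveI := hF₁
  haveI := hX₁int
  haveI := hX₁noeth
  haveI := hF₂
  haveI := hprop
  haveI : IsClosedImmersion (Spec.map (CommRingCat.ofHom θ)) := IsClosedImmersion.spec_of_surjective _ hθ
  haveI hjci : IsClosedImmersion j := MorphismProperty.IsStableUnderBaseChange.of_isPullback hsq.flip inferInstance
  -- `σ' ≫ q` is proper along the chain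
  have hch : Chain P Y X' σ' S' := hChain _ _ _ hChX
  obtain ⟨-, -, hσ'⟩ := chain_isRegular P Y X' σ' S' hch hPnoeth hPreg
  haveI := hσ'
  have hproper : IsProper (σ' ≫ q) := inferInstance
  -- the upstairs centre from the carrier lift
  have hsq₂' : IsPullback j₂ t₂ (τ₁ ≫ σ' ≫ q) (Spec.map (CommRingCat.ofHom θ)) := by
    simpa only [Category.assoc] using hsq₂
  obtain ⟨C, hCreg, hCflat, hCsuppE, hCZ⟩ :=
    HΔ O θ hθ X' (σ' ≫ q) hX'reg hproper U hU s hs hsU hdim X₁ τ₁ hτ₁ F₁ j t hsq x hx hss₀ F₂ υ hυ j₂ t₂ hsq₂' hcomm hE Z hAdm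
  have hCflat' : Flat (C.subschemeι ≫ (τ₁ ≫ σ') ≫ q) := by simpa only [Category.assoc] using hCflat
  have hoffC : (τ₁ ≫ σ') '' (C.support : Set X₁) ⊆ {y | ¬ IsGenericPoint y Y} :=
    off_generic_of_subset_preimage σ' τ₁ (s.ker.support : Set X') hoffs _ fun c hc => by
      have h := hCsuppE hc
      rw [SetLike.mem_coe, Scheme.IdealSheafData.support_comap] at h
      exact h
  -- `T₂ ⊄ supp Z`: `supp Z ⊆ υ⁻¹{x}` and `T₁` has a point other than `x`
  have hZe : (Z.support : Set F₂) ⊆ υ ⁻¹' {x} := by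
    intro z hz
    have hz' : j₂ z ∈ (C.support : Set X₁) := by
      rw [← hCZ, Scheme.IdealSheafData.support_comap] at hz
      exact hz
    have h2 : z ∈ (((s.ker.comap τ₁).comap j₂).support : Set F₂) := by
      rw [Scheme.IdealSheafData.support_comap]
      exact hCsuppE hz'
    rw [hE, Scheme.IdealSheafData.support_comap, TopologicalSpace.Closeds.coe_preimage,
      Scheme.IdealSheafData.coe_support_vanishingIdeal] at h2
    exact h2
  obtain ⟨ξ, hξ⟩ : ∃ ξ : P, IsGenericPoint ξ Y := QuasiSober.sober hYirr hYcl
  obtain ⟨ξ', hfib', hS'⟩ := Chain.fibre hch hξ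
  have hTx : ¬ T₁ ⊆ {x} := by
    intro h
    have hT : T₁ = {x} := by
      refine Set.Subset.antisymm h ?_
      -- `T₁` is non-empty: its image `S' = closure {ξ'}` is
      have hne : S'.Nonempty := by rw [hS']; exact ⟨ξ', subset_closure rfl⟩
      obtain ⟨_, ⟨y, hy, rfl⟩⟩ := (hTS ▸ hne : (j '' T₁).Nonempty)
      rw [Set.singleton_subset_iff, ← h hy]
      exact hy
    have hξ'x : ξ' = j x := by
      have : ξ' ∈ S' := by rw [hS']; exact subset_closure rfl
      rw [← hTS, hT, Set.image_singleton] at this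
      exact this
    apply hoffs (s (IsLocalRing.closedPoint O))
    · obtain ⟨_, -, -, hCsupp⟩ := section_isClosedImmersion_and_isRegular_ker O X' (σ' ≫ q) s hs
      rw [hCsupp]; exact ⟨_, rfl⟩
    · rw [hss₀, ← hξ'x]
      have : σ' ξ' = ξ := by
        have h1 : ξ' ∈ σ' ⁻¹' {ξ} := by rw [hfib']; rfl
        exact h1
      rw [this]; exact hξ
  obtain ⟨y, hyT, hyx⟩ : ∃ y ∈ T₁, y ≠ x := by
    by_contra h
    exact hTx fun y hy => by_contra fun hne => h ⟨y, hy, hne⟩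
  have hTZ : ¬ closure (υ ⁻¹' (T₁ \ {x})) ⊆ (Z.support : Set F₂) := by
    haveI : IsIso (υ ∣_ centreCompl (vanishingIdeal ⟨{x}, hx⟩ : F₁.IdealSheafData)) := hυ.isIso_compl
    have hyc : y ∈ (centreCompl (vanishingIdeal ⟨{x}, hx⟩ : F₁.IdealSheafData) : F₁.Opens) := by
      change y ∈ ((vanishingIdeal ⟨{x}, hx⟩ : F₁.IdealSheafData).support : Set F₁)ᶜ
      rw [Scheme.IdealSheafData.coe_support_vanishingIdeal]
      exact hyx
    obtain ⟨z, hz⟩ := (υ ∣_ centreCompl (vanishingIdeal ⟨{x}, hx⟩ : F₁.IdealSheafData)).surjective ⟨y, hyc⟩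
    have hυz : υ z.1 = y := by
      have h := morphismRestrict_base_coe υ (centreCompl (vanishingIdeal ⟨{x}, hx⟩ : F₁.IdealSheafData)) z
      rw [hz] at h
      exact h.symm
    intro hsub
    have hzT : z.1 ∈ closure (υ ⁻¹' (T₁ \ {x})) := by
      refine subset_closure ?_
      rw [Set.mem_preimage, hυz]
      exact ⟨hyT, hyx⟩
    have hzx : υ z.1 = x := hZe (hsub hzT)
    exact hyx (hυz.symm.trans hzx)
  -- run the engine's iteration brick once
  haveI : IsSeparated (σ' ≫ q) := inferInstance
  obtain ⟨X₉, τ₂, hτ₂⟩ := exists_isBlowup X₁ C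
  obtain ⟨hint₉, hnoeth₉, hreg₉, hdom₉, hF₉, hirr₉, j₉, t₉, hsq₉, -, hCh₉⟩ :=
    modelStep_chain O k θ hθ P q Y hYirr hYcl Ch hChain hStep X₁ (τ₁ ≫ σ') _ hCh₁ hX₁reg hdom₁ F₂ j₂ t₂ hsq₂ _ rfl C Z hCZ
      hCreg hCflat' hoffC hZT hTZ X₉ τ₂ hτ₂ F₉ β hβ
  refine ⟨X₉, τ₂ ≫ τ₁ ≫ σ', _, j₉, t₉, ?_, hint₉, hnoeth₉, hreg₉, ?_, ?_, rfl, isClosed_closure, hirr₉, hF₉⟩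
  · simpa only [Category.assoc] using hCh₉
  · simpa only [Category.assoc] using hdom₉
  · simpa only [Category.assoc] using hsq₉

end Summit.ResolutionOfSingularities.ResolutionOfSingularities.Cruxes.EquisingularLiftNat.Sections

end
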